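import Summits.CriticalPhenomena.Ising3D.TaylorRegionDeltaLitBase
import Mathlib.Tactic.Linarith
import Mathlib.Tactic.Positivity
import Mathlib.Tactic.Ring
import HarnessLib

/-!
# The even region over a wide box from LITERAL tables (certificate-file shape that fits the kernel budget)
(cell `pub-ising3x`, seat recog-1 gen 13; gate (g2) — item (L5) of HOME/pub-ising3x-recog-1/gen12/REGION-ON-MARGIN-FUNCTIONAL.md,
kernel measurements HOME/pub-ising3x-recog-1/gen13/KERNEL-DELTA.md)

HONEST FRAMING: lottery ticket; floor = tightest certified 3D Ising CFT bounds; no exact-solution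
claim without a proof. Island framing: certified exclusion region at stated derivative order and
assumptions; not a determination of the 3D Ising critical exponents beyond that.

WHY. `taylorEvenRegion_of_splitΔ` (TaylorRegionDeltaEven) takes one Boolean `rowLitOK L j` per row; evaluating it
makes the kernel REBUILD the δ-tables `deltaT0/deltaT1/deltaT2` of all four components (1 + 2 + 6 builds each,
36 builds) for every `j` — MEASURED on a real `Λ = 11` functional: 16 s / 34 s / 72 s for the three tables of ONE
component, i.e. ≈ 8 kernel-minutes per row declaration, and the `(E, θ)` tail containment `tailLitOK` (four
`momTableI`) did not finish in 25 minutes. REPAIR (this file): the producer ships the tables themselves as literals.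
* δ-tables: per component `c ∈ {X, Y, Z₃, Z₄}` and order `m ∈ {0, 1, 2}` ONE containment Boolean `tabOK` (one
  declaration each = 1 / 2 / 6 builds); the row triples are then computed from the LITERAL tables (`tripL`,
  `rowLitOKL`: 13 `smulQI` per row — measured 0.03 s per row) and contained in the literal row triples `L[j]` on
  which the landed piece tests run.
* `(E, θ)` tail tables: per component the `(P, D)` box-enclosure table in a literal (`pdLitOK`, one build) and the
  moment substitution row by row (`momRowLitOK`, one declaration per power `r < R` of `θ`, computed from the literal
  `(P, D)` table); the landed tail Booleans then run on the literal `(E, θ)` tables, the `X`/`Y` tails per θ-cell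
  (`tailXCellOKL` / `tailYCellOKL`, like the landed `tailDCellOKL`).
* pieces with PRODUCER BREAKPOINTS (`bp`, `pieceOKB`): the certificate lists the interior breakpoints of every row
  (the leaves of the producer's own bisection), so each piece declaration is one or a few core tests; soundness
  needs no ordering of the breakpoints (`exists_mem_gridCell` takes any function with the right end values).
Main theorem **`taylorEvenRegion_of_splitΔL`**; the proof is the landed one with the containment steps rerouted.
Elementary. [folklore]
-/

namespace Summit.CriticalPhenomena.Ising3D

open Finset Set
open Literature.Analysis.ValidatedNumerics Literature.Analysis.ValidatedNumerics.PolyMP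
open Literature.Analysis.ValidatedNumerics.NumericsMP (MI)
open Literature.MathematicalPhysics.QuantumFieldTheory.ConformalBootstrap3D

namespace EvenRegionDataΔ

variable (d : EvenRegionDataΔ)

/-- The four components `X, Y, Z₃, Z₄`: (weights, sign, centre, half-width). [folklore] -/
def compC : ℕ → (ℕ × ℕ → ℚ) | 0 => d.cQ 0 | 1 => d.cQ 1 | 2 => d.cQ 3 | _ => d.cQ 4
/-- [folklore] -/
def compσ : ℕ → ℚ | 0 => -1 | 1 => -1 | 2 => -1 | _ => 1
/-- [folklore] -/
def comps₀ : ℕ → ℚ | 0 => d.σ0 | 1 => d.ε0 | _ => d.b0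
/-- [folklore] -/
def compW : ℕ → ℚ | 0 => d.Wσ | 1 => d.Wε | _ => d.Wb
/-- box enclosure of the component's exponent (tails) -/
def compI : ℕ → MI
  | 0 => enclQ d.S d.σlo d.σhi
  | 1 => enclQ d.S d.εlo d.εhi
  | _ => enclQ d.S ((d.σlo + d.εlo) / 2) ((d.σhi + d.εhi) / 2)

/-- δ-table containment of component `c`, order `m`. [folklore] -/
def tabOKc (TT : ITab3 × ITab3 × ITab3 × ITab3) (c m : ℕ) : Bool :=
  tabOK d.S (d.compC c) (EvenRegionDataΔ.compσ c) (d.comps₀ c) (d.compW c) d.ccQ d.l (proj4 TT c) m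

/-- Containment of row `j`'s triples computed from the LITERAL δ-tables in ONE literal row triple `Lj` (the form a
certificate chunk file states, mentioning only its own row literal). [folklore] -/
def rowLitRowOK (TT : ITab3 × ITab3 × ITab3 × ITab3) (Lj : ITriple × ITriple × ITriple) (j : ℕ) : Bool :=
  subset3 (tripL (proj4 TT 0) d.N j) Lj.1 && subset3 (tripL (proj4 TT 1) d.N j) Lj.2.1 &&
    subset3 (add3 (tripL (proj4 TT 2) d.N j) (tripL (proj4 TT 3) d.N j)) Lj.2.2

/-- Containment of row `j`'s triples computed from the LITERAL δ-tables in the literal row triples `L[j]`. [folklore] -/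
def rowLitOKL (TT : ITab3 × ITab3 × ITab3 × ITab3) (L : List (ITriple × ITriple × ITriple)) (j : ℕ) : Bool :=
  d.rowLitRowOK TT (L.getD j noLit3) j

/-- `(P, D)` box-enclosure table of component `c` (tails) in the literal `LP c`. [folklore] -/
def pdLitOK (LP : IPoly2 × IPoly2 × IPoly2 × IPoly2) (c : ℕ) : Bool :=
  subset2I (kernelPDLI d.S (d.compC c) (EvenRegionDataΔ.compσ c) (signedChooseI d.S (d.compI c)) d.ccT d.l) (proj4 LP c)

/-- Row `r` of the `(E, θ)` table of component `c`, computed from the LITERAL `(P, D)` table, in the literal `LT c`.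
[folklore] -/
def momRowLitOK (LP LT : IPoly2 × IPoly2 × IPoly2 × IPoly2) (c r : ℕ) : Bool :=
  subsetI (substMomRowI d.S (proj4 LP c) d.ccT d.N r) ((proj4 LT c).getD r [])

/-- The four literal `(E, θ)` tables have `R` rows. [folklore] -/
def tailLenOK (LT : IPoly2 × IPoly2 × IPoly2 × IPoly2) : Bool :=
  decide (LT.1.length = d.R) && decide (LT.2.1.length = d.R) && decide (LT.2.2.1.length = d.R) &&
    decide (LT.2.2.2.length = d.R)

/-- The literal triple the landed tail Booleans see: `(LTX, LTY, LTZ₃ + LTZ₄)`. [folklore] -/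
def tailLT (LT : IPoly2 × IPoly2 × IPoly2 × IPoly2) : IPoly2 × IPoly2 × IPoly2 :=
  (LT.1, LT.2.1, add2I LT.2.2.1 LT.2.2.2)

/-- The `k`-th θ-cell of the `X` tail on the literal table. [folklore] -/
def tailXCellOKL (LT : IPoly2 × IPoly2 × IPoly2 × IPoly2) (k : ℕ) : Bool := hsCell d.S LT.1 (d.E1 - d.ccT) d.prmX k

/-- The `k`-th θ-cell of the `Y` tail on the literal table. [folklore] -/
def tailYCellOKL (LT : IPoly2 × IPoly2 × IPoly2 × IPoly2) (k : ℕ) : Bool := hsCell d.S LT.2.1 (d.E1 - d.ccT) d.prmY k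

/-- Producer breakpoints of ONE row: piece `k` is `[bpRow k, bpRow (k+1)]` with `bpRow 0 = max(E₀, j) − cc`, the interior
points read from `Bj`, and `bpRow (|Bj| + 1) = E₁ − cc` (list default). [folklore] -/
def bpRow (Bj : List ℚ) (j k : ℕ) : ℚ :=
  if k = 0 then max d.E0 (j : ℚ) - d.ccQ else Bj.getD (k - 1) (d.E1 - d.ccQ)

/-- Producer breakpoints: row `j` has `numPieces B j = |B[j]| + 1` pieces. [folklore] -/
def bp (B : List (List ℚ)) (j k : ℕ) : ℚ := d.bpRow (B.getD j []) j k

/-- ONE piece of row `j` on ONE literal row triple with ONE row's breakpoints (chunk-file form). [folklore] -/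
def pieceRowOK (Lj : ITriple × ITriple × ITriple) (Bj : List ℚ) (j k : ℕ) : Bool :=
  decide (d.E1 < max d.E0 (j : ℚ)) ||
  (posOn3 d.S Lj.1.1 Lj.1.2.1 Lj.1.2.2 d.Wσ d.dPj (d.bpRow Bj j k) (d.bpRow Bj j (k + 1)) &&
    posOn3 d.S Lj.2.1.1 Lj.2.1.2.1 Lj.2.1.2.2 d.Wε d.dPj (d.bpRow Bj j k) (d.bpRow Bj j (k + 1)) &&
    posOnDE3 d.S Lj.1 Lj.2.1 Lj.2.2 d.Wσ d.Wε d.Wb d.dPj (d.bpRow Bj j k) (d.bpRow Bj j (k + 1)))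

/-- ONE piece of row `j` with a general breakpoint function. [folklore] -/
def pieceOKF (L : List (ITriple × ITriple × ITriple)) (e : ℕ → ℕ → ℚ) (j k : ℕ) : Bool :=
  decide (d.E1 < max d.E0 (j : ℚ)) ||
  (posOn3 d.S (L.getD j noLit3).1.1 (L.getD j noLit3).1.2.1 (L.getD j noLit3).1.2.2 d.Wσ d.dPj (e j k) (e j (k + 1)) &&
    posOn3 d.S (L.getD j noLit3).2.1.1 (L.getD j noLit3).2.1.2.1 (L.getD j noLit3).2.1.2.2 d.Wε d.dPj (e j k)
      (e j (k + 1)) &&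
    posOnDE3 d.S (L.getD j noLit3).1 (L.getD j noLit3).2.1 (L.getD j noLit3).2.2 d.Wσ d.Wε d.Wb d.dPj (e j k)
      (e j (k + 1)))

/-- ONE piece of row `j` with producer breakpoints `B` (= `pieceRowOK` on `L[j]`, `B[j]`; also `pieceOKF L (bp B)`). [folklore] -/
def pieceOKB (L : List (ITriple × ITriple × ITriple)) (B : List (List ℚ)) (j k : ℕ) : Bool :=
  d.pieceRowOK (L.getD j noLit3) (B.getD j []) j k

/-- [folklore] -/
theorem pieceOKB_eq (L : List (ITriple × ITriple × ITriple)) (B : List (List ℚ)) (j k : ℕ) :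
    d.pieceOKB L B j k = d.pieceOKF L (d.bp B) j k := rfl

/-- [folklore] -/
theorem bp_zero (B : List (List ℚ)) (j : ℕ) : d.bp B j 0 = max d.E0 (j : ℚ) - d.ccQ := by simp [bp, bpRow]

/-- [folklore] -/
theorem bp_numPieces (B : List (List ℚ)) (j : ℕ) : d.bp B j (numPieces B j) = d.E1 - d.ccQ := by
  simp [bp, bpRow, numPieces]

end EvenRegionDataΔ

/-- **The even region over a wide box from literal tables** (all hypotheses after `hl` are kernel Booleans / decidable
props on rational data, each meant to be ONE small declaration of a certificate file). [folklore] -/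
theorem taylorEvenRegion_of_splitΔL (d : EvenRegionDataΔ) (LP LT : IPoly2 × IPoly2 × IPoly2 × IPoly2)
    (TT : ITab3 × ITab3 × ITab3 × ITab3) (L : List (ITriple × ITriple × ITriple)) (B : List (List ℚ))
    (hl : d.l.Nodup) (hs : d.sizesOK = true)
    (hnX : 0 < d.prmX.nθ) (hnY : 0 < d.prmY.nθ) (hlen : d.tailLenOK LT = true)
    (hPD : ∀ c : ℕ, c < 4 → d.pdLitOK LP c = true)
    (hmom : ∀ c r : ℕ, c < 4 → r < d.R → d.momRowLitOK LP LT c r = true)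
    (hX : ∀ k : ℕ, k < d.prmX.nθ → d.tailXCellOKL LT k = true)
    (hY : ∀ k : ℕ, k < d.prmY.nθ → d.tailYCellOKL LT k = true)
    (hD : ∀ k : ℕ, k < d.prmD.nθ → d.toH.tailDCellOKL (EvenRegionDataΔ.tailLT LT) k = true)
    (hT : ∀ c m : ℕ, c < 4 → m < 3 → d.tabOKc TT c m = true)
    (hr : ∀ j : ℕ, j < d.J1 + 1 → d.rowLitOKL TT L j = true)
    (hpc : ∀ j k : ℕ, j < d.J1 + 1 → k < numPieces B j → d.pieceOKB L B j k = true) :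
    TaylorEvenRegion (taylorCrossing (1 / 2) (1 / 2) d.l.toFinset fun i ab => (d.cQ i ab : ℝ))
      (Icc (d.σlo : ℝ) d.σhi ×ˢ Icc (d.εlo : ℝ) d.εhi) ((d.E0 : ℚ) : ℝ) := by
  simp only [EvenRegionDataΔ.sizesOK, EvenRegionDataH.sizesOK, Bool.and_eq_true, decide_eq_true_eq] at hs
  obtain ⟨⟨⟨⟨⟨⟨⟨⟨⟨⟨⟨⟨⟨⟨⟨⟨⟨hS, hE0⟩, hJ1⟩, hR⟩, hN0⟩, hN1⟩, hN3⟩, hN4⟩, hθX⟩, hθY⟩, hθD⟩, hnD⟩, hσ⟩, hε⟩,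
    hZX⟩, hZY⟩, hZ3⟩, hZ4⟩ := hs
  simp only [EvenRegionDataΔ.tailLenOK, Bool.and_eq_true, decide_eq_true_eq] at hlen
  obtain ⟨⟨⟨lX, lY⟩, lZ3⟩, lZ4⟩ := hlen
  -- normalise the `toH` projections to the fields of `d` (all definitional)
  have hS : 0 < d.S := hS
  have hE0 : 0 < d.E0 := hE0
  have hJ1 : d.E1 ≤ (d.J1 : ℚ) + 1 := hJ1
  have hR : momLenOK d.N d.R = true := hR
  have hN0 : kernelSizeOK d.S (d.cQ 0) (-1) (enclQ d.S d.σlo d.σhi) d.ccT d.l d.N = true := hN0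
  have hN1 : kernelSizeOK d.S (d.cQ 1) (-1) (enclQ d.S d.εlo d.εhi) d.ccT d.l d.N = true := hN1
  have hN3 : kernelSizeOK d.S (d.cQ 3) (-1) (enclQ d.S ((d.σlo + d.εlo) / 2) ((d.σhi + d.εhi) / 2)) d.ccT d.l d.N =
      true := hN3
  have hN4 : kernelSizeOK d.S (d.cQ 4) 1 (enclQ d.S ((d.σlo + d.εlo) / 2) ((d.σhi + d.εhi) / 2)) d.ccT d.l d.N =
      true := hN4
  have hθX : 1 ≤ d.prmX.θhi := hθX
  have hθY : 1 ≤ d.prmY.θhi := hθY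
  have hθD : 1 ≤ d.prmD.θhi := hθD
  have hnD : 0 < d.prmD.nθ := hnD
  -- the split containments, component by component (definitional unfolding of `proj4` / `comp*`)
  have pdX : subset2I (kernelPDLI d.S (d.cQ 0) (-1) (signedChooseI d.S (enclQ d.S d.σlo d.σhi)) d.ccT d.l) LP.1 =
      true := hPD 0 (by norm_num)
  have pdY : subset2I (kernelPDLI d.S (d.cQ 1) (-1) (signedChooseI d.S (enclQ d.S d.εlo d.εhi)) d.ccT d.l) LP.2.1 =
      true := hPD 1 (by norm_num)
  have pd3 : subset2I (kernelPDLI d.S (d.cQ 3) (-1)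
      (signedChooseI d.S (enclQ d.S ((d.σlo + d.εlo) / 2) ((d.σhi + d.εhi) / 2))) d.ccT d.l) LP.2.2.1 = true :=
    hPD 2 (by norm_num)
  have pd4 : subset2I (kernelPDLI d.S (d.cQ 4) 1
      (signedChooseI d.S (enclQ d.S ((d.σlo + d.εlo) / 2) ((d.σhi + d.εhi) / 2))) d.ccT d.l) LP.2.2.2 = true :=
    hPD 3 (by norm_num)
  have mrX : ∀ r : ℕ, r < d.R → subsetI (substMomRowI d.S LP.1 d.ccT d.N r) (LT.1.getD r []) = true :=
    fun r hr => hmom 0 r (by norm_num) hr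
  have mrY : ∀ r : ℕ, r < d.R → subsetI (substMomRowI d.S LP.2.1 d.ccT d.N r) (LT.2.1.getD r []) = true :=
    fun r hr => hmom 1 r (by norm_num) hr
  have mr3 : ∀ r : ℕ, r < d.R → subsetI (substMomRowI d.S LP.2.2.1 d.ccT d.N r) (LT.2.2.1.getD r []) = true :=
    fun r hr => hmom 2 r (by norm_num) hr
  have mr4 : ∀ r : ℕ, r < d.R → subsetI (substMomRowI d.S LP.2.2.2 d.ccT d.N r) (LT.2.2.2.getD r []) = true :=
    fun r hr => hmom 3 r (by norm_num) hr
  have tX : ∀ m : ℕ, m < 3 → tabOK d.S (d.cQ 0) (-1) d.σ0 d.Wσ d.ccQ d.l TT.1 m = true :=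
    fun m hm => hT 0 m (by norm_num) hm
  have tY : ∀ m : ℕ, m < 3 → tabOK d.S (d.cQ 1) (-1) d.ε0 d.Wε d.ccQ d.l TT.2.1 m = true :=
    fun m hm => hT 1 m (by norm_num) hm
  have t3 : ∀ m : ℕ, m < 3 → tabOK d.S (d.cQ 3) (-1) d.b0 d.Wb d.ccQ d.l TT.2.2.1 m = true :=
    fun m hm => hT 2 m (by norm_num) hm
  have t4 : ∀ m : ℕ, m < 3 → tabOK d.S (d.cQ 4) 1 d.b0 d.Wb d.ccQ d.l TT.2.2.2 m = true :=
    fun m hm => hT 3 m (by norm_num) hm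
  have hXall : halfStripPos2 d.S LT.1 (d.E1 - d.ccT) d.prmX = true :=
    halfStripPos2_of_hsCells (lt_of_lt_of_le zero_lt_one hθX) hnX hX
  have hYall : halfStripPos2 d.S LT.2.1 (d.E1 - d.ccT) d.prmY = true :=
    halfStripPos2_of_hsCells (lt_of_lt_of_le zero_lt_one hθY) hnY hY
  have hDall : halfStripPosD d.S LT.1 LT.2.1 (add2I LT.2.2.1 LT.2.2.2) (d.E1 - d.ccT) d.prmD = true :=
    halfStripPosD_of_cells (lt_of_lt_of_le zero_lt_one hθD) hnD hD
  have hWσ : 0 ≤ d.Wσ := by unfold EvenRegionDataΔ.Wσ; linarith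
  have hWε : 0 ≤ d.Wε := by unfold EvenRegionDataΔ.Wε; linarith
  have hWb : 0 ≤ d.Wb := by unfold EvenRegionDataΔ.Wb; linarith
  refine taylorEvenRegion_half_of_qRegion _ _ _ _ fun p hp E j hE hj => ?_
  obtain ⟨h1, h2, h3, h4⟩ : (d.σlo : ℝ) ≤ p.1 ∧ p.1 ≤ d.σhi ∧ (d.εlo : ℝ) ≤ p.2 ∧ p.2 ≤ d.εhi := by
    simp only [Set.mem_prod, Set.mem_Icc] at hp; exact ⟨hp.1.1, hp.1.2, hp.2.1, hp.2.2⟩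
  have hsσ : MI.mem d.S p.1 (enclQ d.S d.σlo d.σhi) := mem_enclQ _ h1 h2
  have hsε : MI.mem d.S p.2 (enclQ d.S d.εlo d.εhi) := mem_enclQ _ h3 h4
  have hsb : MI.mem d.S ((p.1 + p.2) / 2) (enclQ d.S ((d.σlo + d.εlo) / 2) ((d.σhi + d.εhi) / 2)) :=
    mem_enclQ _ (by push_cast; linarith) (by push_cast; linarith)
  have hEpos : 0 < E := lt_of_lt_of_le (by exact_mod_cast hE0) hE
  by_cases hE1 : ((d.E1 : ℚ) : ℝ) ≤ E
  · -- TAIL: the landed (E, θ) machinery on the LITERAL tables (containment through the literal (P, D) tables)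
    have hθ := div_mem_unit hEpos hj
    have hP : ((d.E1 - d.ccT : ℚ) : ℝ) ≤ E - d.ccT := by push_cast; linarith
    have eX := qSum_eq_eval2_momTable hS (d.cQ 0) (-1) hsσ d.ccT hl hN0 hR hEpos j
    have eY := qSum_eq_eval2_momTable hS (d.cQ 1) (-1) hsε d.ccT hl hN1 hR hEpos j
    have eZ3 := qSum_eq_eval2_momTable hS (d.cQ 3) (-1) hsb d.ccT hl hN3 hR hEpos j
    have eZ4 := qSum_eq_eval2_momTable hS (d.cQ 4) 1 hsb d.ccT hl hN4 hR hEpos j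
    have pX : PMem2 d.S (momTable (d.cQ 0) (-1) p.1 d.ccT d.l d.N d.R) LT.1 :=
      pmem2_substMom_of_rows hS (pmem2_of_subset2I (pmem2_kernelPDLI_of_mem hS hsσ (d.cQ 0) (-1) d.ccT d.l) pdX)
        d.ccT d.N d.R lX mrX
    have pY : PMem2 d.S (momTable (d.cQ 1) (-1) p.2 d.ccT d.l d.N d.R) LT.2.1 :=
      pmem2_substMom_of_rows hS (pmem2_of_subset2I (pmem2_kernelPDLI_of_mem hS hsε (d.cQ 1) (-1) d.ccT d.l) pdY)
        d.ccT d.N d.R lY mrY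
    have pZ3 : PMem2 d.S (momTable (d.cQ 3) (-1) ((p.1 + p.2) / 2) d.ccT d.l d.N d.R) LT.2.2.1 :=
      pmem2_substMom_of_rows hS (pmem2_of_subset2I (pmem2_kernelPDLI_of_mem hS hsb (d.cQ 3) (-1) d.ccT d.l) pd3)
        d.ccT d.N d.R lZ3 mr3
    have pZ4 : PMem2 d.S (momTable (d.cQ 4) 1 ((p.1 + p.2) / 2) d.ccT d.l d.N d.R) LT.2.2.2 :=
      pmem2_substMom_of_rows hS (pmem2_of_subset2I (pmem2_kernelPDLI_of_mem hS hsb (d.cQ 4) 1 d.ccT d.l) pd4)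
        d.ccT d.N d.R lZ4 mr4
    have pZ := pmem2_add2I pZ3 pZ4
    have vX := halfStripPos2_sound hS pX hXall hP hθ.1 (hθ.2.trans (by exact_mod_cast hθX))
    have vY := halfStripPos2_sound hS pY hYall hP hθ.1 (hθ.2.trans (by exact_mod_cast hθY))
    have vD := halfStripPosD_sound hS pX pY pZ hDall hP hθ.1 (hθ.2.trans (by exact_mod_cast hθD))
    rw [eval2_add2] at vD
    simp only [Rat.cast_neg, Rat.cast_one] at eX eY eZ3 eZ4
    have goalD : (qSum (fun ab => (d.cQ 3 ab : ℝ)) d.l.toFinset ((p.1 + p.2) / 2) (-1) E j +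
        qSum (fun ab => (d.cQ 4 ab : ℝ)) d.l.toFinset ((p.1 + p.2) / 2) 1 E j) ^ 2 ≤
        4 * qSum (fun ab => (d.cQ 0 ab : ℝ)) d.l.toFinset p.1 (-1) E j *
          qSum (fun ab => (d.cQ 1 ab : ℝ)) d.l.toFinset p.2 (-1) E j := by
      rw [eX, eY, eZ3, eZ4, sq]; linarith
    exact ⟨by rw [eX]; exact vX.le, by rw [eY]; exact vY.le, goalD⟩
  · -- BOUNDED PART: δ-expanded row triples from the literal tables
    have hElt : E < d.E1 := lt_of_not_ge hE1
    have hjJ : j < d.J1 + 1 := by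
      have h1' : (j : ℝ) < (d.J1 : ℝ) + 1 := by
        have : ((d.E1 : ℚ) : ℝ) ≤ (d.J1 : ℝ) + 1 := by exact_mod_cast hJ1
        linarith
      exact_mod_cast h1'
    -- the three δ's
    have hδσ : |p.1 - d.σ0| ≤ d.Wσ := by
      unfold EvenRegionDataΔ.σ0 EvenRegionDataΔ.Wσ; push_cast; rw [abs_le]; constructor <;> linarith
    have hδε : |p.2 - d.ε0| ≤ d.Wε := by
      unfold EvenRegionDataΔ.ε0 EvenRegionDataΔ.Wε; push_cast; rw [abs_le]; constructor <;> linarith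
    have hδb : |(p.1 + p.2) / 2 - d.b0| ≤ d.Wb := by
      unfold EvenRegionDataΔ.b0 EvenRegionDataΔ.Wb EvenRegionDataΔ.σ0 EvenRegionDataΔ.Wσ EvenRegionDataΔ.ε0
        EvenRegionDataΔ.Wε
      push_cast; rw [abs_le]; constructor <;> linarith
    -- the four q-sums as triples
    have eX := qSum_eq_delta_rows hS (d.cQ 0) (-1) d.σ0 hWσ d.ccQ hl hZX hδσ E j
    have eY := qSum_eq_delta_rows hS (d.cQ 1) (-1) d.ε0 hWε d.ccQ hl hZY hδε E j
    have eZ3 := qSum_eq_delta_rows hS (d.cQ 3) (-1) d.b0 hWb d.ccQ hl hZ3 hδb E j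
    have eZ4 := qSum_eq_delta_rows hS (d.cQ 4) 1 d.b0 hWb d.ccQ hl hZ4 hδb E j
    have aσ : ((d.σ0 : ℚ) : ℝ) + (p.1 - d.σ0) = p.1 := by ring
    have aε : ((d.ε0 : ℚ) : ℝ) + (p.2 - d.ε0) = p.2 := by ring
    have ab : ((d.b0 : ℚ) : ℝ) + ((p.1 + p.2) / 2 - d.b0) = (p.1 + p.2) / 2 := by ring
    rw [aσ] at eX; rw [aε] at eY; rw [ab] at eZ3 eZ4
    simp only [Rat.cast_neg, Rat.cast_one] at eX eY eZ3 eZ4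
    -- memberships of the real triples in the triples from the literal tables, then in the literal rows
    have qX := pmem3_tripL hS (d.cQ 0) (-1) d.σ0 hWσ d.ccQ d.l tX d.N j hδσ
    have qY := pmem3_tripL hS (d.cQ 1) (-1) d.ε0 hWε d.ccQ d.l tY d.N j hδε
    have q3 := pmem3_tripL hS (d.cQ 3) (-1) d.b0 hWb d.ccQ d.l t3 d.N j hδb
    have q4 := pmem3_tripL hS (d.cQ 4) 1 d.b0 hWb d.ccQ d.l t4 d.N j hδb
    have qZ := pmem3_add q3 q4
    have hrow := hr j hjJ
    simp only [EvenRegionDataΔ.rowLitOKL, EvenRegionDataΔ.rowLitRowOK, Bool.and_eq_true] at hrow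
    obtain ⟨⟨sX, sY⟩, sZ⟩ := hrow
    have mX := pmem3_of_subset3 qX sX
    have mY := pmem3_of_subset3 qY sY
    have mZ := pmem3_of_subset3 qZ sZ
    -- locate the piece of P = E − cc among the producer breakpoints
    have hmE2 : max (d.E0 : ℝ) (j : ℝ) ≤ E := max_le hE hj
    set K : ℕ := numPieces B j with hKdef
    have hK : 0 < K := numPieces_pos B j
    have e0 : d.bp B j 0 = max d.E0 (j : ℚ) - d.ccQ := d.bp_zero B j
    have eK : d.bp B j K = d.E1 - d.ccQ := d.bp_numPieces B j
    have hn1 : K - 1 + 1 = K := Nat.sub_add_cancel hK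
    obtain ⟨k, hk, hk1, hk2⟩ := exists_mem_gridCell (fun k : ℕ => ((d.bp B j k : ℚ) : ℝ)) (K - 1)
      (Δ := E - d.ccQ) (by show ((d.bp B j 0 : ℚ) : ℝ) ≤ E - d.ccQ; rw [e0]; push_cast; linarith [hmE2])
      (by show E - d.ccQ ≤ ((d.bp B j (K - 1 + 1) : ℚ) : ℝ); rw [hn1, eK]; push_cast; linarith)
    have hkK : k < K := by omega
    have hpiece := hpc j k hjJ hkK
    rw [EvenRegionDataΔ.pieceOKB_eq] at hpiece
    simp only [EvenRegionDataΔ.pieceOKF, Bool.or_eq_true, Bool.and_eq_true, decide_eq_true_eq] at hpiece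
    rcases hpiece with hvac | ⟨⟨rX, rY⟩, rD⟩
    · exfalso
      have hmE : ((max d.E0 (j : ℚ) : ℚ) : ℝ) ≤ E := by push_cast; exact hmE2
      have : ((d.E1 : ℚ) : ℝ) < ((max d.E0 (j : ℚ) : ℚ) : ℝ) := by exact_mod_cast hvac
      linarith
    have vX := posOn3_sound hS hWσ mX.fst mX.snd mX.thd rX hk1 hk2 hδσ
    have vY := posOn3_sound hS hWε mY.fst mY.snd mY.thd rY hk1 hk2 hδε
    obtain ⟨-, -, vD⟩ := posOnDE3_sound hS hWσ hWε hWb mX mY mZ rD hk1 hk2 hδσ hδε hδb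
    rw [val3_add] at vD
    simp only [val3] at vD
    refine ⟨?_, ?_, ?_⟩
    · rw [eX]; exact vX.le
    · rw [eY]; exact vY.le
    · rw [eX, eY, eZ3, eZ4, sq]; linarith [vD]

end Summit.CriticalPhenomena.Ising3D
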